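import Literature.AnabelianGeometry.SemiGraphs.TemperedAnabelianThm64SubCompactCase
import Literature.AnabelianGeometry.SemiGraphs.TemperedAnabelianThm64SubTowerWitness
import Literature.AnabelianGeometry.SemiGraphs.TemperedAnabelianLem63iiProofs
import Literature.AnabelianGeometry.SemiGraphs.TemperedAnabelianWitness
import Literature.AnabelianGeometry.SemiGraphs.TemperedOriginGenuineNonVacuity
import HarnessLib

/-!
# [SemiAnbd] Thm. 6.4 sub-DAG: the step predicates T64-L01 / T64-L01b / T64-L04 at the IDENTITY datum
# (instance forms MODEL-WITNESSED; joint satisfiability of all seven steps with a nonempty datum)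

S. Mochizuki, *Semi-graphs of anabelioids*, Publ. RIMS **42** (2006) [SemiAnbd], §6, Theorem 6.4 and its
proof, kurims p. 70 l. −9 – p. 71 l. 11; [Mzk8] = S. Mochizuki, *Galois sections in absolute anabelian
geometry*, Nagoya Math. J. **179** (2005), Thm. 1.2 p. 5. [cite: MochizukiSemiAnbd2006, Thm 6.4 proof p.71]

PROOF-ONLY companion (theorems only; no definition, no new fact) of `TemperedAnabelianThm64Sub.lean`
(abc-iut-w5-d139), cell abc-iut, seat abc-iut-f-170 (FACT-PROVING wave, plan/F-TRANCHES.tsv tranche 170: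
FROZEN FACT-LIST rows F-2831 `TemperedCurve.GeometricIsDFG`, F-2832
`TemperedCurve.GeometricIsGaloisCompatible`, F-2836 `TemperedCurve.ProfiniteAnabelianTheorem`).

The three rows are PREDICATES on the interface datum `C : TemperedCurveHom p X Y` (the abstract set of
dominant morphisms `C.DomHom` with the abstract tempered-`π₁` functor `C.pi1`).  Their UNIVERSAL CLOSURES
were refuted at DEGENERATE data (`C.pi1 ≡ 1`, `C.DomHom := Empty`) by abc-iut-w4-d025
(`TemperedAnabelianThm64SubSchemas.lean`: `not_forall_geometricIsDFG`, `not_forall_geometricIsGaloisCompatible`,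
`not_forall_profiniteAnabelianTheorem`).  This file supplies the complementary half of the FACT-LIST
reading "universal-closure REFUTED / schema; instance forms MODEL-WITNESSED": the three predicates, and
indeed ALL SEVEN step hypotheses of the assembly `TemperedCurve.temperedAnabelianTheorem_of_steps`
(T64-L01, L01b, L02, L03a, L03b, L04, L07) together with T64-L06′, hold SIMULTANEOUSLY at a datum with a
NONEMPTY set of "dominant morphisms" — the IDENTITY datum `⟨Unit, fun _ => id⟩` ("the only dominant
morphism `X_K → X_K` is the identity, and `π₁^temp(id) = id`"):

* `geometricIsGaloisCompatible_id` — T64-L01b holds at the identity datum of EVERY `X : TemperedCurve p`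
  (the identity lies over `G_K → G_K`, `h ↦ 1⁻¹ h 1`);
* `geometricIsDFG_id_iff` — T64-L01 at the identity datum of `X` is EQUIVALENT to: every discrete
  quotient `Π^temp_{X_K}/J` (`J` open normal) is finitely generated (the image of `Π^temp` is dense in
  the open subgroup `Π` itself); hence it holds for compact `Π^temp` (`geometricIsDFG_id_of_compactSpace`)
  and under the virtually-free tower input of [André] §4.5 (`geometricIsDFG_id_of_tower`), in particular at
  the cell's NON-COMPACT tempered witness (`exists_noncompact_identityDatum_steps`: there every step of
  the sub-DAG except T64-L04 holds at the identity datum);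
* T64-L02 = Lemma 6.3 (ii) for a datum with `Π^temp_{X_K}` compact is abc-iut-w6-d055's
  `piTempDFGIffDOF_of_compactSpace` (`TemperedOriginGenuineNonVacuity.lean`), consumed by name;
* `profiniteAnabelianTheorem_id_degenerate` — T64-L04 = [Mzk8] Thm. 1.2 read on the interface HOLDS at
  the identity datum of the degenerate inhabitant `TemperedCurve.degenerate p` (abc-iut-c312-4:
  `Π^temp = Π = G_{ℚ_p}`, `K = ℚ_p`, augmentation `= id`): there an open homomorphism `Φ : Π → Π` over some
  `h ↦ g⁻¹ h g` IS `h ↦ g⁻¹ h g`, i.e. every Galois-compatible open `Φ` is `Π`-conjugate to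
  `π₁(id) = id`, and injectivity on the one-element set of morphisms is trivial;
* `exists_identityDatum_allSteps` — the JOINT witness: some `Y : TemperedCurve p` and
  `C : TemperedCurveHom p Y Y` with `C.DomHom` nonempty satisfy T64-L01 ∧ L01b ∧ L02 ∧ L03a ∧ L03b ∧ L04 ∧
  L06′ ∧ L07, and the typed node `TemperedAnabelianTheorem C` ([SemiAnbd] Thm. 6.4 as typed) holds there.

HONEST LIMITS.  Consistency evidence about the interface only: neither `G_{ℚ_p}` nor `F₂ × G_{ℚ_p}` is the
tempered fundamental group of a hyperbolic curve, and the genuine datum of Thm. 6.4 (all dominant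
morphisms `X_K → Y_L`, André's `π₁^temp` functor) is not in the tree; nothing of [SemiAnbd] / [Mzk8] /
[André] is asserted or denied; typed ≠ proved; nothing here takes a side on [IUTchIII] Cor. 3.12.
-/

noncomputable section

namespace Literature.AnabelianGeometry.SemiGraphs

namespace TemperedCurve

open _root_.Topology

variable {p : ℕ} [Fact p.Prime]

/-! ### T64-L01b at the identity datum: always -/

/-- **F-2832 / T64-L01b at the identity datum of any `X`.**  The identity of `Π^temp_{X_K}` fits into the
commutative diagram over `G_K → G_K`, `h ↦ 1⁻¹ h 1` (the embedding `K ↪ K` being the identity, `g = 1`).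
[cite: MochizukiSemiAnbd2006, Thm 6.4 pp.70-71] -/
theorem geometricIsGaloisCompatible_id (X : TemperedCurve p) :
    GeometricIsGaloisCompatible
      (⟨Unit, fun _ => ContinuousMonoidHom.id X.PiTemp⟩ : TemperedCurveHom p X X) := by
  intro _
  refine ⟨1, ?_, fun x => by simp⟩
  have h1 : ((1 : GQp p) : AlgebraicClosure ℚ_[p] →ₐ[ℚ_[p]] AlgebraicClosure ℚ_[p]) =
      AlgHom.id ℚ_[p] (AlgebraicClosure ℚ_[p]) := by
    ext x; rfl
  rw [h1, IntermediateField.map_id]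

/-! ### T64-L01 at the identity datum ⟺ the discrete quotients of `Π^temp` are finitely generated -/

/-- **F-2831 / T64-L01 at the identity datum of `X`, characterised.**  `π₁^temp(id) = id` is of DFG-type
iff `Π^temp_{X_K}` itself is a subgroup of DFG-type ([SemiAnbd] Def. 6.2 (i)): its image is dense in the
open subgroup `Π_{X_K}` of the completion (always), and its image in every discrete quotient
`Π^temp_{X_K}/J`, `J` open normal, is finitely generated — i.e. iff all these quotients are finitely
generated groups. [cite: MochizukiSemiAnbd2006, Def 6.2(i) pp.69-70] -/
theorem geometricIsDFG_id_iff (X : TemperedCurve p) :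
    GeometricIsDFG (⟨Unit, fun _ => ContinuousMonoidHom.id X.PiTemp⟩ : TemperedCurveHom p X X) ↔
      ∀ J : OpenNormalSubgroup X.PiTemp, Group.FG (X.PiTemp ⧸ J.toSubgroup) := by
  have hrange : ((ContinuousMonoidHom.id X.PiTemp).toMonoidHom.range : Subgroup X.PiTemp) = ⊤ :=
    MonoidHom.range_eq_top.mpr fun x => ⟨x, rfl⟩
  constructor
  · intro h J
    have h1 : IsDFGTypeHom X.toHat (ContinuousMonoidHom.id X.PiTemp) := h ()
    unfold IsDFGTypeHom at h1
    rw [hrange] at h1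
    have h2 := h1.2 J
    rw [Subgroup.map_top_of_surjective _ (QuotientGroup.mk'_surjective _)] at h2
    exact Group.fg_def.mpr h2
  · intro hFG u
    show IsDFGTypeHom X.toHat (ContinuousMonoidHom.id X.PiTemp)
    unfold IsDFGTypeHom
    rw [hrange]
    refine ⟨⟨⊤, ?_, ?_⟩, fun J => ?_⟩
    · rw [Subgroup.coe_top]; exact isOpen_univ
    · rw [Subgroup.coe_top, Subgroup.coe_top, Set.image_univ]
      exact X.isProfiniteCompletion_toHat.denseRange.closure_range
    · rw [Subgroup.map_top_of_surjective _ (QuotientGroup.mk'_surjective _)]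
      exact Group.fg_def.mp (hFG J)

/-- T64-L01 at the identity datum under the virtually-free tower input on `Π^temp_{X_K}` ([André] §4.5:
a neighbourhood basis of `1` of open normal `N` with `Π^temp/N` an extension of a finite group by a
finitely generated free group): the discrete quotients are then finitely generated.
[cite: MochizukiSemiAnbd2006, Thm 6.4 proof p.71] -/
theorem geometricIsDFG_id_of_tower (X : TemperedCurve p)
    (htower₀ : ∀ U ∈ 𝓝 (1 : X.PiTemp), ∃ N : OpenNormalSubgroup X.PiTemp, (N : Set X.PiTemp) ⊆ U ∧
      ∃ (G : Subgroup (X.PiTemp ⧸ N.toSubgroup)) (_ : IsFreeGroup G), G.Normal ∧ G.FiniteIndex ∧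
        Finite (IsFreeGroup.Generators G) ∧ ∃ a ∈ G, ∃ b ∈ G, a * b ≠ b * a) :
    GeometricIsDFG (⟨Unit, fun _ => ContinuousMonoidHom.id X.PiTemp⟩ : TemperedCurveHom p X X) := by
  refine (geometricIsDFG_id_iff X).mpr fun J' => ?_
  obtain ⟨J, hJ, hfg, -⟩ :=
    virtuallyFreeQuotients_of_tower htower₀ _ (J'.isOpen.mem_nhds J'.toSubgroup.one_mem)
  haveI := hfg
  have hle : J.toSubgroup ≤ J'.toSubgroup := fun x hx => hJ hx
  refine Group.fg_of_surjective
    (f := QuotientGroup.map J.toSubgroup J'.toSubgroup (MonoidHom.id X.PiTemp) fun x hx => hle hx) ?_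
  intro y
  obtain ⟨x, rfl⟩ := QuotientGroup.mk_surjective y
  exact ⟨x, rfl⟩

/-! ### Compact `Π^temp`: the discrete quotients are finite (`Π^temp ↪ Π` onto and Lemma 6.3 (ii) in this
case: `toHat_surjective_of_compactSpace`, `piTempDFGIffDOF_of_compactSpace`, abc-iut-w6-d055) -/

/-- If `Π^temp_{X_K}` is compact, its discrete quotients `Π^temp_{X_K}/J` (`J` open normal) are finite,
hence finitely generated. [cite: MochizukiSemiAnbd2006, Def 6.2(i) pp.69-70] -/
theorem fg_quotient_of_compactSpace (X : TemperedCurve p) [CompactSpace X.PiTemp]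
    (J : OpenNormalSubgroup X.PiTemp) : Group.FG (X.PiTemp ⧸ J.toSubgroup) := by
  haveI : Finite (X.PiTemp ⧸ J.toSubgroup) := Subgroup.quotient_finite_of_isOpen _ J.isOpen
  infer_instance

/-- **F-2831 / T64-L01 at the identity datum of a compact `Π^temp`.**
[cite: MochizukiSemiAnbd2006, Thm 6.4 proof p.71] -/
theorem geometricIsDFG_id_of_compactSpace (X : TemperedCurve p) [CompactSpace X.PiTemp] :
    GeometricIsDFG (⟨Unit, fun _ => ContinuousMonoidHom.id X.PiTemp⟩ : TemperedCurveHom p X X) :=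
  (geometricIsDFG_id_iff X).mpr X.fg_quotient_of_compactSpace

/-! ### The degenerate inhabitant: Galois-compatible open endomorphisms of `Π = G_{ℚ_p}` are inner -/

/-- `Π^temp = G_{ℚ_p}` of the degenerate inhabitant is compact (it is its own profinite completion).
[cite: MochizukiSemiAnbd2006, §6 p.69] -/
theorem compactSpace_piTemp_degenerate (p : ℕ) [Fact p.Prime] :
    CompactSpace (TemperedCurve.degenerate p).PiTemp :=
  (TemperedCurve.degenerate p).isProfiniteCompletion_toHat.compactSpace

/-- **F-2836 / T64-L04 ([Mzk8] Thm. 1.2 read on the interface) at the identity datum of the degenerate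
inhabitant.**  There `K = ℚ_p`, `Π^temp = Π = G_{ℚ_p}` and both augmentations are the identity, so an
OPEN `Φ : Π → Π` lying over some `h ↦ g⁻¹ h g` is that map itself: it is `Π`-conjugate (by `c = g⁻¹`) to
`π₁(id) = id` on `Π^temp` (surjectivity half), and the injectivity half is trivial on the one-element set
of morphisms.  Consistency evidence for the hypothesis `h04`; [Mzk8] Thm. 1.2 is not asserted.
[cite: MochizukiSemiAnbd2006, Thm 6.4 proof p.71] -/
theorem profiniteAnabelianTheorem_id_degenerate (p : ℕ) [Fact p.Prime] :
    ProfiniteAnabelianTheorem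
      (⟨Unit, fun _ => ContinuousMonoidHom.id (TemperedCurve.degenerate p).PiTemp⟩ :
        TemperedCurveHom p (TemperedCurve.degenerate p) (TemperedCurve.degenerate p)) := by
  refine ⟨fun Φ hΦ => ?_, fun f f' _ => Subsingleton.elim _ _⟩
  obtain ⟨-, g, -, hg⟩ := hΦ
  refine ⟨(), g⁻¹, fun x => ?_⟩
  -- at the degenerate inhabitant `Π^temp = Π = G_{ℚ_p}` and `toHat = augHat = id`, so the goal
  -- `Φ (ι x) = g⁻¹ · ι (id x) · (g⁻¹)⁻¹` is, definitionally, the compatibility `augHat (Φ x) = g⁻¹ · augHat x · g`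
  change (TemperedCurve.degenerate p).augHat (Φ x) =
    g⁻¹ * (TemperedCurve.degenerate p).augHat x * g⁻¹⁻¹
  rw [inv_inv]
  exact hg x

/-- **F-2831 at the degenerate inhabitant**: T64-L01 holds at its identity datum (`G_{ℚ_p}` compact).
[cite: MochizukiSemiAnbd2006, Thm 6.4 proof p.71] -/
theorem geometricIsDFG_id_degenerate (p : ℕ) [Fact p.Prime] :
    GeometricIsDFG
      (⟨Unit, fun _ => ContinuousMonoidHom.id (TemperedCurve.degenerate p).PiTemp⟩ :
        TemperedCurveHom p (TemperedCurve.degenerate p) (TemperedCurve.degenerate p)) :=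
  haveI := compactSpace_piTemp_degenerate p
  geometricIsDFG_id_of_compactSpace _

/-- **T64-L02 at the degenerate inhabitant**: Lemma 6.3 (ii) for `Π^temp = G_{ℚ_p}`.
[cite: MochizukiSemiAnbd2006, Lem 6.3(ii) p.70] -/
theorem piTempDFGIffDOF_degenerate (p : ℕ) [Fact p.Prime] :
    (TemperedCurve.degenerate p).PiTempDFGIffDOF :=
  haveI := compactSpace_piTemp_degenerate p
  piTempDFGIffDOF_of_compactSpace _

/-- **[SemiAnbd] Thm. 6.4 AS TYPED holds at the identity datum of the degenerate inhabitant**: all its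
inputs are witnessed there (`temperedAnabelianTheorem_of_inputs_of_toHat_surjective`, abc-iut-w4-d076).
[cite: MochizukiSemiAnbd2006, Thm 6.4 pp.70-71] -/
theorem temperedAnabelianTheorem_id_degenerate (p : ℕ) [Fact p.Prime] :
    TemperedAnabelianTheorem
      (⟨Unit, fun _ => ContinuousMonoidHom.id (TemperedCurve.degenerate p).PiTemp⟩ :
        TemperedCurveHom p (TemperedCurve.degenerate p) (TemperedCurve.degenerate p)) :=
  temperedAnabelianTheorem_of_inputs_of_toHat_surjective _ (toHat_surjective_degenerate p)
    (geometricIsDFG_id_degenerate p) (geometricIsGaloisCompatible_id _) (piTempDFGIffDOF_degenerate p)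
    (profiniteAnabelianTheorem_id_degenerate p)

/-! ### Joint satisfiability of the sub-DAG's step hypotheses with a nonempty datum -/

/-- **F-2831 / F-2832 / F-2836 MODEL-WITNESSED JOINTLY with the other steps.**  There are
`Y : TemperedCurve p` and a datum `C : TemperedCurveHom p Y Y` with a NONEMPTY set of dominant morphisms
at which every step hypothesis of `temperedAnabelianTheorem_of_steps` — T64-L01 `GeometricIsDFG`,
T64-L01b `GeometricIsGaloisCompatible`, T64-L02 `PiTempDFGIffDOF`, T64-L03a `CompletionExtends`,
T64-L03b `CompletionOpenOfDOF`, T64-L04 `ProfiniteAnabelianTheorem`, T64-L07 `OuterDescent` — and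
T64-L06′ `OpenDenseDOFConjugator` hold together, as does the typed node `TemperedAnabelianTheorem C`
(the identity datum of the degenerate inhabitant; consistency evidence only).
[cite: MochizukiSemiAnbd2006, Thm 6.4 proof p.71] -/
theorem exists_identityDatum_allSteps (p : ℕ) [Fact p.Prime] :
    ∃ (Y : TemperedCurve p) (C : TemperedCurveHom p Y Y), Nonempty C.DomHom ∧
      GeometricIsDFG C ∧ GeometricIsGaloisCompatible C ∧ Y.PiTempDFGIffDOF ∧
      CompletionExtends Y Y ∧ CompletionOpenOfDOF Y Y ∧ ProfiniteAnabelianTheorem C ∧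
      Y.OpenDenseDOFConjugator ∧ OuterDescent Y Y ∧ TemperedAnabelianTheorem C :=
  ⟨TemperedCurve.degenerate p, ⟨Unit, fun _ => ContinuousMonoidHom.id _⟩, ⟨()⟩,
    geometricIsDFG_id_degenerate p, geometricIsGaloisCompatible_id _, piTempDFGIffDOF_degenerate p,
    completionExtends_holds _ _, completionOpenOfDOF_holds _ _, profiniteAnabelianTheorem_id_degenerate p,
    openDenseDOFConjugator_degenerate p, outerDescent_degenerate p _,
    temperedAnabelianTheorem_id_degenerate p⟩

/-- **At the cell's NON-COMPACT tempered witness** (abc-iut-w5-d240: `Π^temp = F₂ × G_{ℚ_p}`, `F₂`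
discrete free of rank two, `Π = F̂₂ × G_{ℚ_p}`): at the identity datum every step of the sub-DAG EXCEPT
T64-L04 holds — T64-L01 (f.g. discrete quotients, from the tower), T64-L01b, T64-L02 and T64-L06′/L07
(tower proofs), T64-L03a/b (classical) — so there [Mzk8] Thm. 1.2 is the only input of Thm. 6.4 not
witnessed (and is not claimed). [cite: MochizukiSemiAnbd2006, Thm 6.4 proof p.71] -/
theorem exists_noncompact_identityDatum_steps (p : ℕ) [Fact p.Prime] :
    ∃ Y : TemperedCurve p, IsTempered Y.PiTemp ∧ ¬ CompactSpace Y.PiTemp ∧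
      GeometricIsDFG (⟨Unit, fun _ => ContinuousMonoidHom.id Y.PiTemp⟩ : TemperedCurveHom p Y Y) ∧
      GeometricIsGaloisCompatible
        (⟨Unit, fun _ => ContinuousMonoidHom.id Y.PiTemp⟩ : TemperedCurveHom p Y Y) ∧
      Y.PiTempDFGIffDOF ∧ CompletionExtends Y Y ∧ CompletionOpenOfDOF Y Y ∧
      Y.OpenDenseDOFConjugator ∧ OuterDescent Y Y := by
  obtain ⟨Y, hT, hnc, htower⟩ := exists_temperedCurve_isTempered_tower (p := p)
  have h06 : Y.OpenDenseDOFConjugator := Y.openDenseDOFConjugator_of_tower hT htower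
  exact ⟨Y, hT, hnc, geometricIsDFG_id_of_tower Y htower, geometricIsGaloisCompatible_id Y,
    Y.piTempDFGIffDOF_of_tower htower, completionExtends_holds Y Y, completionOpenOfDOF_holds Y Y, h06,
    outerDescent_of_openDenseDOFConjugator Y Y h06⟩

end TemperedCurve

end Literature.AnabelianGeometry.SemiGraphs

end
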